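import Summits.CriticalPhenomena.PercolationContinuityZ3.Theorems.PercNearOneGluingNoHeavyLowerTailSahiC3CombCube
import Summits.CriticalPhenomena.PercolationContinuityZ3.Theorems.PercNearOneGluingNoHeavyLowerTailSahiC3CubeFour

/-!
# `NoHeavyLowerTail` (crux stmt-CriticalPhenomena-4575): (M⁺-3) and twisted three-partition positivity (★★) on every ground set of
# size `≤ 4` — COMPUTATIONAL companion of `…SahiC3CombCube` (uses the `native_decide` certificate `SahiC3Cube.checkCube_four`)

Support file (cell `prim-l12`, seat P3, gen 2; `--supports stmt-CriticalPhenomena-4575`; proposed `--computational`: every theorem here has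
`SahiC3Cube.checkCube_four` (`native_decide`, `Lean.ofReduceBool`) in its axiom closure; nothing else non-standard, no `sorry`).

* `combPos_sahiE_three_cube_le_four` — (M⁺-3) for every triple of increasing events of the cube `Fin m`, `m ≤ 4`;
* `combPos_sahiE_three_of_card_le_four` — the same on every ground set with at most four elements (relabelling transport);
* `threePartNT_nonneg_of_card_le_four` — **(★★) for `|ι| ≤ 4`, every twist, is a theorem**: this is exactly the exhaustive census of
  `…ThreePartitionADTwisted` ("all `(triple, τ)` for `m ≤ 4`: 12 871 040 pairs, 0 negative"), now certified in the kernel via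
  prim-sahi's Kronecker-number check and the bridge `ThreePartition.threePartNT_nonneg_of_combPos`.
-/

noncomputable section

open scoped Classical

namespace Summit.CriticalPhenomena.PercolationContinuityZ3.Theorems

namespace SahiC3CombCube

open Finset Function SahiC3Cube SahiComb
open Literature.Combinatorics.Sahi2008
open Literature.Probability.Percolation.DecisionTree (ind)

/-- **(M⁺-3) on the cubes `Fin m`, `m ≤ 4`** (the `m = 4` level from the `native_decide` certificate `checkCube_four`). [this work] -/
theorem combPos_sahiE_three_cube_le_four {m : ℕ} (hm : m ≤ 4) {A B C : Set (Set (Fin m))} (hA : IsUpperSet A) (hB : IsUpperSet B)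
    (hC : IsUpperSet C) : CombPos (fun _ : Fin m => 3) (fun p => sahiE (bernoulliWeight p) 3 ![ind A, ind B, ind C]) := by
  rcases Nat.lt_or_ge m 4 with h | h
  · exact combPos_sahiE_three_cube_le_three (by omega) hA hB hC
  · have hm4 : m = 4 := le_antisymm hm h
    subst hm4
    exact combPos_sahiE_three_of_checkCube checkCube_four hA hB hC

/-- **(M⁺-3) on every ground set with at most four elements**, every triple of increasing events. [this work] -/
theorem combPos_sahiE_three_of_card_le_four {ι : Type} [Fintype ι] (hι : Fintype.card ι ≤ 4) {U V W : Set (Set ι)}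
    (hU : IsUpperSet U) (hV : IsUpperSet V) (hW : IsUpperSet W) :
    CombPos (fun _ : ι => 3) (fun p => sahiE (bernoulliWeight p) 3 ![ind U, ind V, ind W]) :=
  combPos_sahiE_three_of_fin U V W fun e =>
    combPos_sahiE_three_cube_le_four hι (SahiC4CombBridge.isUpperSet_comapFam e hU)
      (SahiC4CombBridge.isUpperSet_comapFam e hV) (SahiC4CombBridge.isUpperSet_comapFam e hW)

/-- The same in the shape of `MasterFamilyCombPos 3` (families `U : Fin 3 → Set (Set ι)`). [this work] -/
theorem combPos_sahiE_three_family_of_card_le_four {ι : Type} [Fintype ι] (hι : Fintype.card ι ≤ 4)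
    (U : Fin 3 → Set (Set ι)) (hU : ∀ j, IsUpperSet (U j)) :
    CombPos (fun _ : ι => 3) (fun p => sahiE (bernoulliWeight p) 3 (fun j => ind (U j))) :=
  (ThreePartition.combPos_vec_iff U).2 (combPos_sahiE_three_of_card_le_four hι (hU 0) (hU 1) (hU 2))

/-- **(★★) on ground sets of size `≤ 4`, every twist**: `threePartNT τ 𝒰 𝒱 𝒲 ≥ 0` for all up-sets of a ground set with at most four
elements — the exhaustive `m ≤ 4` census of `…ThreePartitionADTwisted`, now a kernel-certified theorem. [this work] -/
theorem threePartNT_nonneg_of_card_le_four {ι : Type} [Fintype ι] (hι : Fintype.card ι ≤ 4) (τ : Set ι)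
    {U V W : Set (Set ι)} (hU : IsUpperSet U) (hV : IsUpperSet V) (hW : IsUpperSet W) :
    0 ≤ ThreePartition.threePartNT τ U V W :=
  ThreePartition.threePartNT_nonneg_of_combPos τ (combPos_sahiE_three_of_card_le_four hι hU hV hW)

/-- In particular the untwisted slice: `threePartN 𝒰 𝒱 𝒲 ≥ 0` (`ThreePartitionPositivity` of `…ThreePartitionAD`) on ground sets of size
`≤ 4`. [this work] -/
theorem threePartN_nonneg_of_card_le_four {ι : Type} [Fintype ι] (hι : Fintype.card ι ≤ 4)
    {U V W : Set (Set ι)} (hU : IsUpperSet U) (hV : IsUpperSet V) (hW : IsUpperSet W) :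
    0 ≤ ThreePartition.threePartN U V W := by
  rw [← ThreePartition.threePartNT_empty]
  exact threePartNT_nonneg_of_card_le_four hι ∅ hU hV hW

end SahiC3CombCube

end Summit.CriticalPhenomena.PercolationContinuityZ3.Theorems
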